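import Summits.ValiantsHypothesis.ValiantsHypothesis.Theorems.KPlusLogSqLawTropicalShiftGridDefs
import Summits.ValiantsHypothesis.ValiantsHypothesis.Theorems.KPlusLogSqLawTropicalShiftLadderChain

/-!
# Route «KPlusLogSqLaw» — SHIFT-GRID, part 1: digits, the gauge identity, the grid incidences

HONEST FRAMING.  Proof file (pure theorems) of the helper chain `--supports` the crux
`Summit.ValiantsHypothesis.ValiantsHypothesis.Theses.KPlusLogSqLaw.TropicalB` (item `stmt-ValiantsHypothesis-19771`, route `KPlusLogSqLaw`;
cell `pub-symmetroid`, seat val-sym-trop-p5 g8, 2026-08-27); the design is described in `…TropicalShiftGridDefs.lean`.  Nothing here asserts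
`TropicalB`, `WeakLifting`, `KPlusLogSqLaw`, `MatrixDescartes` or anything about `VP ≠ VNP`.

CONTENTS.  Digits `lo l ≤ A`, `hi l ≤ E`, `l = lo l + (A+1)·hi l` (`eq_of_digits`); the tropical weight of ANY Leibniz term is the sum of the
gauged per-incidence scores (`tropWeight_eq_sum_phi`, from `ShiftLadder.sum_redistribute`), and since the support is full the gauge identity
`hi·D + κ·shift − D·[wrap] = κ·(effective shift)` is pure algebra: `φ = g_θ(eshift) + bonus(θ, eshift, b, lo)` for EVERY incidence (`phi_eq`).
The grid incidence of column `b` in phase `p ≤ E·m` at step `a ≤ A·m` has digits `(lvl a b, hlv p b)` (`lo_lam`, `hi_lam`, `hlv_le`), wraps iff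
`m ≤ b + (p mod m)` (`wrap_cterm_iff`), has effective shift exactly `p` (`eshift_cterm`) and score `g_θ(p) + bonus(θ, p, b, lvl a b)`
(`phi_cterm`).  Part 2 (`…TropicalShiftGridChain.lean`) inverts the effective shift, proves dominance and runs the chain.
-/

set_option linter.dupNamespace false
set_option autoImplicit false

namespace Summit.ValiantsHypothesis.ValiantsHypothesis.Theorems.LacunarySymmetroidMatrixDescartes.TropicalCensus

open Summit.ValiantsHypothesis.ValiantsHypothesis.Theorems.MatrixDescartes.Negative
open scoped BigOperators
open Finset

namespace ShiftGrid

open ShiftThree (shiftZ)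
open ShiftSquare (rot)
open ShiftLadder (width kap bigD pen priceSum hsign th lvl gval bonus grid)

variable (A E n : ℕ)

/-! ### the two digits of a class -/

/-- the high digit is at most `E`. -/
theorem hi_le (l : Fin ((A + 1) * (E + 1))) : hi A E l ≤ E := by
  unfold hi
  have hl : (l : ℕ) < (A + 1) * (E + 1) := l.isLt
  have : (l : ℕ) / (A + 1) < E + 1 := Nat.div_lt_of_lt_mul hl
  omega

/-- the low digit is at most `A`. -/
theorem lo_le (l : Fin ((A + 1) * (E + 1))) : lo A E l ≤ A := by
  unfold lo
  have := Nat.mod_lt (l : ℕ) (show 0 < A + 1 by omega)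
  omega

/-- digit decomposition `l = lo l + (A+1)·hi l`. -/
theorem lo_add_hi (l : Fin ((A + 1) * (E + 1))) : lo A E l + (A + 1) * hi A E l = (l : ℕ) := by
  unfold lo hi
  exact Nat.mod_add_div _ _

/-- two classes with the same digits are equal. -/
theorem eq_of_digits {l l' : Fin ((A + 1) * (E + 1))} (h1 : lo A E l = lo A E l') (h2 : hi A E l = hi A E l') : l = l' := by
  apply Fin.ext
  rw [← lo_add_hi A E l, ← lo_add_hi A E l', h1, h2]

/-- the exponent in digit form (cast to `ℤ`). -/
theorem dd_cast (l : Fin ((A + 1) * (E + 1))) : (dd A E n l : ℤ) = (lo A E l : ℤ) + (hi A E l : ℤ) * (bigD A n : ℤ) := by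
  unfold dd; push_cast; ring

/-! ### the gauge -/

/-- the tropical weight is the sum of the corrected per-incidence scores. -/
theorem tropWeight_eq_sum_phi (θ : ℤ) (q : Equiv.Perm (Fin (n + 1)) × (Fin (n + 1) → Fin ((A + 1) * (E + 1)))) :
    tropWeight (dd A E n) (vv A E n) θ q = ∑ b, phi A E n θ (q.1 b) b (q.2 b) := by
  unfold tropWeight phi
  have h0 := ShiftLadder.sum_redistribute A n q.1
  rw [Finset.sum_sub_distrib, Finset.sum_add_distrib, Finset.sum_sub_distrib, ← Finset.mul_sum]
  have h3 : ∑ b, θ * (kap A n : ℤ) * shiftZ n (q.1 b) b -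
      ∑ b, θ * (bigD A n : ℤ) * (if ((q.1 b : Fin (n + 1)) : ℕ) < (b : ℕ) then 1 else 0) = 0 := by
    rw [← Finset.sum_sub_distrib]
    have : ∀ b, θ * (kap A n : ℤ) * shiftZ n (q.1 b) b -
        θ * (bigD A n : ℤ) * (if ((q.1 b : Fin (n + 1)) : ℕ) < (b : ℕ) then 1 else 0)
        = θ * ((kap A n : ℤ) * shiftZ n (q.1 b) b -
          (bigD A n : ℤ) * (if ((q.1 b : Fin (n + 1)) : ℕ) < (b : ℕ) then 1 else 0)) := fun b => by ring
    rw [Finset.sum_congr rfl (fun b _ => this b), ← Finset.mul_sum, h0, mul_zero]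
  linarith

/-- score of ANY incidence: `g_θ(effective shift) + bonus` (the gauge identity `hi·D + κ·shift − D·[wrap] = κ·eshift` is pure algebra). -/
theorem phi_eq (θ : ℤ) (a b : Fin (n + 1)) (l : Fin ((A + 1) * (E + 1))) :
    phi A E n θ a b l = gval A n θ (eshift A E n a b l) + bonus A n θ (eshift A E n a b l) b (lo A E l) := by
  have hD := ShiftLadder.bigD_cast A n
  unfold phi ShiftLadder.gval vv ShiftLadder.bonus eshift
  rw [dd_cast, hD]
  ring

/-! ### the grid incidences -/

/-- the high digit is at most `E` when `p ≤ E·m`. -/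
theorem hlv_le (p : ℕ) (hp : p ≤ E * (n + 1)) (b : Fin (n + 1)) : hlv n p b ≤ E := by
  unfold hlv
  have h := Nat.div_add_mod p (n + 1)
  have hc := Nat.mod_lt p (show 0 < n + 1 by omega)
  have hb := b.isLt
  have hi : p / (n + 1) ≤ E := by
    calc p / (n + 1) ≤ E * (n + 1) / (n + 1) := Nat.div_le_div_right hp
      _ = E := Nat.mul_div_cancel E (show 0 < n + 1 by omega)
  by_cases hw : n + 1 ≤ (b : ℕ) + p % (n + 1)
  · rw [if_pos hw]
    by_contra hcon
    have hE : p / (n + 1) = E := by omega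
    have : (n + 1) * E + 1 ≤ p := by rw [← hE]; omega
    nlinarith
  · rw [if_neg hw]; omega

/-- digits of the grid class: low rung `min A (lvl a b)` … -/
theorem lo_lam (p a : ℕ) (b : Fin (n + 1)) : lo A E (lam A E n p a b) = min A (lvl n a b) := by
  unfold lo lam
  dsimp only
  rw [Nat.add_mul_mod_self_left, Nat.mod_eq_of_lt]
  exact Nat.lt_succ_of_le (min_le_left _ _)

/-- … and high digit `min E (hlv p b)`. -/
theorem hi_lam (p a : ℕ) (b : Fin (n + 1)) : hi A E (lam A E n p a b) = min E (hlv n p b) := by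
  unfold hi lam
  dsimp only
  rw [Nat.add_mul_div_left _ _ (Nat.succ_pos A), Nat.div_eq_of_lt (Nat.lt_succ_of_le (min_le_left _ _)),
    Nat.zero_add]

/-- the rotation part of a phase is `< m`. -/
theorem mod_lt' (p : ℕ) : p % (n + 1) < n + 1 := Nat.mod_lt p (by omega)

/-- the grid's entry in column `b` wraps iff `m ≤ b + (p mod m)`. -/
theorem wrap_cterm_iff (p : ℕ) (b : Fin (n + 1)) :
    ((rot n (p % (n + 1)) b : Fin (n + 1)) : ℕ) < (b : ℕ) ↔ n + 1 ≤ (b : ℕ) + p % (n + 1) := by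
  have hq := mod_lt' n p
  rw [ShiftSquare.rot_val n (p % (n + 1)) hq.le b]
  split_ifs with h <;> constructor <;> intro h' <;> omega

/-- the effective shift of the grid incidence in column `b` is the phase `p ≤ E·m`. -/
theorem eshift_cterm (p a : ℕ) (hp : p ≤ E * (n + 1)) (b : Fin (n + 1)) :
    eshift A E n (rot n (p % (n + 1)) b) b (lam A E n p a b) = p := by
  unfold eshift
  rw [hi_lam, min_eq_right (hlv_le E n p hp b), ShiftSquare.shiftZ_rot_of_lt n _ (mod_lt' n p) b]
  unfold hlv
  have h := Nat.div_add_mod p (n + 1)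
  have h' : ((n : ℤ) + 1) * (p / (n + 1) : ℕ) + (p % (n + 1) : ℕ) = p := by exact_mod_cast h
  by_cases hw : n + 1 ≤ (b : ℕ) + p % (n + 1)
  · rw [if_pos hw, if_pos ((wrap_cterm_iff n p b).mpr hw)]; push_cast; linarith
  · rw [if_neg hw, if_neg (fun h'' => hw ((wrap_cterm_iff n p b).mp h''))]; push_cast; linarith

/-- `|lsign l| = 1`. -/
theorem lsign_natAbs (l : Fin ((A + 1) * (E + 1))) : (lsign A E n l).natAbs = 1 := by
  unfold lsign
  rw [Int.natAbs_mul, Int.natAbs_pow, Int.natAbs_neg, Int.natAbs_one, one_pow, one_mul, Int.natAbs_pow,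
    ShiftLadder.hsign_natAbs, one_pow]

/-- every incidence is present. -/
theorem ee_ne_zero (a b : Fin (n + 1)) (l : Fin ((A + 1) * (E + 1))) : ee A E n a b l ≠ 0 := by
  unfold ee; rw [← Int.natAbs_ne_zero, lsign_natAbs]; exact one_ne_zero

/-- the design's signs lie in `{−1, 1}`. -/
theorem ee_natAbs (a b : Fin (n + 1)) (l : Fin ((A + 1) * (E + 1))) : (ee A E n a b l).natAbs ≤ 1 := by
  unfold ee; rw [lsign_natAbs]

/-- score of the grid incidence in column `b` at slope `θ`: `g_θ(p) + bonus(θ, p, b, lvl)`, for `p ≤ E·m`, `a ≤ A·m`. -/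
theorem phi_cterm (θ : ℤ) (p a : ℕ) (hp : p ≤ E * (n + 1)) (ha : a ≤ A * (n + 1)) (b : Fin (n + 1)) :
    phi A E n θ (rot n (p % (n + 1)) b) b (lam A E n p a b) = gval A n θ p + bonus A n θ p b (lvl n a b) := by
  rw [phi_eq, eshift_cterm A E n p a hp, lo_lam, min_eq_right (ShiftLadder.lvl_le A n a ha b)]

end ShiftGrid

end Summit.ValiantsHypothesis.ValiantsHypothesis.Theorems.LacunarySymmetroidMatrixDescartes.TropicalCensus
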